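import Summits.QuantumFields.GaugeBoot.Certificates.SparseReducedWindow
import Summits.QuantumFields.GaugeBoot.Certificates.KZL2rpD4EntA
import Summits.QuantumFields.GaugeBoot.Certificates.KZL2rpD4EntB
import Summits.QuantumFields.GaugeBoot.Certificates.KZL2rpD4EntC
import Summits.QuantumFields.GaugeBoot.Certificates.KZL2rpD4EntD
import Summits.QuantumFields.GaugeBoot.Certificates.KZL2rpD4EntE
import Summits.QuantumFields.GaugeBoot.Certificates.KZL2rpD4EntF
import Summits.QuantumFields.GaugeBoot.Certificates.KZL2rpD4EntG
import Summits.QuantumFields.GaugeBoot.Certificates.KZL2rpD4EntH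
import Summits.QuantumFields.GaugeBoot.Certificates.KZL2rpD4EntI
import Summits.QuantumFields.GaugeBoot.Certificates.KZL2rpD4EntJ
import Summits.QuantumFields.GaugeBoot.Certificates.KZL2rpD4EntK
import Summits.QuantumFields.GaugeBoot.Certificates.KZL2rpD4EntL
import Summits.QuantumFields.GaugeBoot.Certificates.KZL2rpD4EntM
import Summits.QuantumFields.GaugeBoot.Certificates.KZL2rpD4EntN
import Summits.QuantumFields.GaugeBoot.Certificates.KZL2rpD4EntO
import Summits.QuantumFields.GaugeBoot.Certificates.KZL2rpD4EntP
import Summits.QuantumFields.GaugeBoot.Certificates.KZL2rpD4EntQ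
import Summits.QuantumFields.GaugeBoot.Certificates.KZL2rpD4EntR
import Summits.QuantumFields.GaugeBoot.Certificates.KZL2rpD4EntS
import Summits.QuantumFields.GaugeBoot.Certificates.KZL2rpD4EntT
import Summits.QuantumFields.GaugeBoot.Certificates.KZL2rpD4EntU
import Summits.QuantumFields.GaugeBoot.Certificates.KZL2rpD4EntV
import Summits.QuantumFields.GaugeBoot.Certificates.KZL2rpD4EntW
import Summits.QuantumFields.GaugeBoot.Certificates.KZL2rpD4EntX
import Summits.QuantumFields.GaugeBoot.Certificates.KZL2rpD4EntY
import Summits.QuantumFields.GaugeBoot.Certificates.KZL2rpD4EntZ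
import Summits.QuantumFields.GaugeBoot.Certificates.KZL2rpD4EntAA
import Summits.QuantumFields.GaugeBoot.Certificates.KZL2rpD4EntAB
import Summits.QuantumFields.GaugeBoot.Certificates.KZL2rpD4EntAC
import Summits.QuantumFields.GaugeBoot.Certificates.KZL2rpD4EntAD
import Summits.QuantumFields.GaugeBoot.Certificates.KZL2rpD4EntAE
import Summits.QuantumFields.GaugeBoot.Certificates.KZL2rpD4EntAF
import Summits.QuantumFields.GaugeBoot.Certificates.KZL2rpD4EntAG
import Summits.QuantumFields.GaugeBoot.Certificates.KZL2rpD4EntAH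
import Summits.QuantumFields.GaugeBoot.Certificates.KZL2rpD4EntAI
import Summits.QuantumFields.GaugeBoot.Certificates.KZL2rpD4EntAJ
import Summits.QuantumFields.GaugeBoot.Certificates.KZL2rpD4EntAK
import Summits.QuantumFields.GaugeBoot.Certificates.KZL2rpD4EntAL
import Summits.QuantumFields.GaugeBoot.Certificates.KZL2rpD4EntAM
import Summits.QuantumFields.GaugeBoot.Certificates.KZL2rpD4EntAN
import Summits.QuantumFields.GaugeBoot.Certificates.KZL2rpD4EntAO
import Summits.QuantumFields.GaugeBoot.Certificates.KZL2rpD4EntAP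
import Summits.QuantumFields.GaugeBoot.Certificates.KZL2rpD4EntAQ
import Summits.QuantumFields.GaugeBoot.Certificates.KZL2rpD4EntAR
import Summits.QuantumFields.GaugeBoot.Certificates.KZL2rpD4EntAS
import HarnessLib

/-!
# Kernel checks of the reduced problem family `KZL2rpD4`, part A: tables, dimension and row-length checks (gb_lean_emit_win 0.9)

HONEST FRAMING (cell `pub-gaugeboot`): certified bounds on lattice expectations at stated coupling,
gauge group, dimension and torus size; NOT a mass gap, NOT a continuum limit, NOT a string tension;
NOT Yang–Mills-summit-bearing (barriers `FixedCouplingUltralocality`, `PerturbativeInvisibility`).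
Family `KZL2rpD4` (10878 variables, 70 reduced blocks of dimensions `dimL`, max 48; signature sha256
`981d7f3d6150831051c56aaad864b12ea5331c9f99b4a9ca7663ff81a1066429`): WINDOW ROUTE (emitter 0.9, support `Certificates/SparseReducedWindow.lean`) — this module assembles
the entry tables `EB` from the data parts and runs the two β-independent kernel checks `dimCheck` (entries outside a block's
own dimension are empty) and `rowLenCheck` (stored row `i` has ≤ `m − i` entries, so the raw-recursor sweep agrees with the
counted one). The binding interface `dim`/`ent`/`redBlock`/`redBlock_apply` is in `Certificates/KZL2rpD4Tab.lean`.
Nothing is claimed about lattice gauge theory in this file.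
-/

namespace Summit.QuantumFields.GaugeBoot.Certificates.KZL2rpD4

noncomputable section

open Matrix Summit.QuantumFields.GaugeBoot.Certificates.Sparse

/-- The upper-triangular entry tables of all blocks (data parts assembled in block order). -/
def EB : List (List (List (List (ℕ × ℤ)))) := EBa0 ++ [EBb0 ++ EBc0] ++ EBd0 ++ EBe0 ++ EBf0 ++ EBg0 ++ [EBg1 ++ EBh0] ++ EBh1 ++ EBi0 ++ [EBi1 ++ EBj0 ++ EBk0] ++ [EBk1 ++ EBl0] ++ [EBl1 ++ EBm0] ++ EBm1 ++ EBn0 ++ [EBn1 ++ EBo0 ++ EBp0] ++ EBp1 ++ EBq0 ++ [EBq1 ++ EBr0 ++ EBs0] ++ EBt0 ++ EBu0 ++ [EBu1 ++ EBv0] ++ [EBv1 ++ EBw0] ++ [EBw1 ++ EBx0] ++ EBx1 ++ [EBx2 ++ EBy0 ++ EBz0 ++ EBaa0] ++ EBaa1 ++ [EBaa2 ++ EBab0] ++ [EBab1 ++ EBac0] ++ [EBac1 ++ EBad0] ++ EBad1 ++ EBae0 ++ [EBae1 ++ EBaf0 ++ EBag0 ++ EBah0] ++ EBah1 ++ EBai0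 ++ [EBai1 ++ EBaj0] ++ [EBaj1 ++ EBak0] ++ EBal0 ++ [EBal1 ++ EBam0] ++ EBam1 ++ [EBam2 ++ EBan0 ++ EBao0] ++ EBao1 ++ EBap0 ++ [EBap1 ++ EBaq0] ++ [EBaq1 ++ EBar0] ++ [EBar1 ++ EBas0]

set_option maxHeartbeats 0 in
/-- Kernel check: entries outside each block's own dimension are empty (padding to 48×48). -/
theorem dim_chk : dimCheck EB dimL 48 70 = true := by
  decide +kernel

set_option maxHeartbeats 0 in
/-- Kernel check: stored row `i` of every block has at most `48 − i` entries. -/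
theorem row_len : rowLenCheck EB 48 70 = true := by
  decide +kernel

end

end Summit.QuantumFields.GaugeBoot.Certificates.KZL2rpD4
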